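import Mathlib
import HarnessLib

/-!
# The two-point affine `L^{3/2}` lower bound (first lemma (α) of line `galilean-frames`, F3 lever L3)
# (crux `EulerZoomLiouville.PowerGaugeEulerLiouville` = stmt-NavierStokesRegularity-19832; ideator ns-idea-11 g6, critic V48 P2; width seat ns-ezl-w1 g4)

Route №10 `EulerZoomLiouville` (NavierStokesRegularity).  Line `galilean-frames` (`Cruxes/PowerGaugeEulerLiouville/Lines/galilean_frames.lean`)
reduces WANDERING self-similar members to anchored ones (F3): the weak Euler equation makes the fictitious force of a wandering centre a
LINEAR pressure `−⟪b(τ), Y⟫`, and the pressure gauge `∫∫_{Q_a}|p|^{3/2} ≤ c a^{2−2ρ}` forbids two different values of `b` because an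
affine function is large in `L^{3/2}` of big balls, UNIFORMLY IN ITS CONSTANT TERM.  This file proves that quantitative heart, typed by
the critic as `Sig.lemma_affineL32LowerBound` (statement VERBATIM):

* **`affineL32LowerBound`** — `∃ κ > 0, ∀ b c L, 0 < L → κ ‖b‖^{3/2} L^{9/2} ≤ ∫_{B_L} |⟪b, Y⟫ − c|^{3/2} dY`.

Proof (no compactness, explicit `κ = v₁/512`, `v₁ = vol B₁`): for `b ≠ 0`, `e = b/‖b‖`, the quarter ball `B(∓(L/2)e, L/4) ⊂ B_L` (sign
opposite to the sign of `c`) carries `|⟪b, Y⟫ − c| ≥ ‖b‖ L/4`, so the integral is at least `(‖b‖L/4)^{3/2} · (L/4)³ v₁ = (v₁/512) ‖b‖^{3/2} L^{9/2}`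
(`4^{9/2} = 512`); `b = 0` is trivial.

HONEST LABEL: pure-analysis helper (first lemma of F3, not a stub of the composition).  WHAT THIS IS NOT: not NS, not E — `--supports`
stmt-19832; 19832 OPEN; NS regularity NOT proved. [folklore]
-/

noncomputable section

-- flat `Theorems/<Route><Decl>…` files of one crux share the namespace of the crux (tree convention)
set_option linter.dupNamespace false

open MeasureTheory Set Filter Topology Metric Function InnerProductSpace
open scoped RealInnerProductSpace NNReal ENNReal

namespace Summit.NavierStokesRegularity.NavierStokesRegularity.Theorems.PowerGaugeEulerLiouville.GalileanFrames

/-- `4^{9/2} = 512`. [folklore] -/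
theorem four_rpow_nine_halves : (4 : ℝ) ^ (9 / 2 : ℝ) = 512 := by
  rw [show (4 : ℝ) = 2 ^ (2 : ℝ) by norm_num, ← Real.rpow_mul (by norm_num)]
  norm_num

/-- **THE TWO-POINT AFFINE `L^{3/2}` LOWER BOUND** (`Sig.lemma_affineL32LowerBound` of `Lines/galilean_frames.lean`, VERBATIM): there is
`κ > 0` (here `κ = vol(B₁)/512`) such that for every `b ∈ ℝ³`, every constant `c` and every radius `L > 0`,
`κ ‖b‖^{3/2} L^{9/2} ≤ ∫_{B_L(0)} |⟪b, Y⟫ − c|^{3/2} dY` — an affine function cannot be small in `L^{3/2}` of a big ball, uniformly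
in its constant term (the quarter ball `B(∓(L/2) b/‖b‖, L/4)`, on the side opposite to the sign of `c`, carries `|⟪b,Y⟫ − c| ≥ ‖b‖L/4`).
[folklore] -/
theorem affineL32LowerBound :
    ∃ κ : ℝ, 0 < κ ∧ ∀ (b : EuclideanSpace ℝ (Fin 3)) (c L : ℝ), 0 < L →
      κ * ‖b‖ ^ (3 / 2 : ℝ) * L ^ (9 / 2 : ℝ) ≤
        ∫ Y in Metric.ball (0 : EuclideanSpace ℝ (Fin 3)) L, |⟪b, Y⟫ - c| ^ (3 / 2 : ℝ) := by
  set v₁ : ℝ := (volume (ball (0 : EuclideanSpace ℝ (Fin 3)) 1)).toReal with hv₁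
  have hv : 0 < v₁ := ENNReal.toReal_pos (measure_ball_pos volume _ one_pos).ne' measure_ball_lt_top.ne
  refine ⟨v₁ / 512, by positivity, fun b c L hL => ?_⟩
  -- the integrand
  set f : EuclideanSpace ℝ (Fin 3) → ℝ := fun Y => |⟪b, Y⟫ - c| ^ (3 / 2 : ℝ) with hf
  have hf0 : ∀ Y, 0 ≤ f Y := fun Y => Real.rpow_nonneg (abs_nonneg _) _
  have hfc : Continuous f :=
    ((continuous_const.inner continuous_id).sub continuous_const).abs.rpow_const fun _ => Or.inr (by norm_num)
  have hfi : IntegrableOn f (ball (0 : EuclideanSpace ℝ (Fin 3)) L) :=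
    (hfc.continuousOn.integrableOn_compact (isCompact_closedBall (0 : EuclideanSpace ℝ (Fin 3)) L)).mono_set
      ball_subset_closedBall
  have hInonneg : 0 ≤ ∫ Y in ball (0 : EuclideanSpace ℝ (Fin 3)) L, f Y :=
    setIntegral_nonneg measurableSet_ball fun Y _ => hf0 Y
  by_cases hb : b = 0
  · have : ‖b‖ ^ (3 / 2 : ℝ) = 0 := by rw [hb, norm_zero, Real.zero_rpow (by norm_num)]
    rw [this, mul_zero, zero_mul]
    exact hInonneg
  -- `b ≠ 0`: the unit vector `e` and the quarter ball
  have hbn : 0 < ‖b‖ := norm_pos_iff.2 hb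
  set e : EuclideanSpace ℝ (Fin 3) := ‖b‖⁻¹ • b with he_def
  have he : ‖e‖ = 1 := by rw [he_def, norm_smul, norm_inv, norm_norm, inv_mul_cancel₀ hbn.ne']
  have hbe : ∀ Y : EuclideanSpace ℝ (Fin 3), ⟪b, Y⟫ = ‖b‖ * ⟪e, Y⟫ := fun Y => by
    rw [he_def, real_inner_smul_left, ← mul_assoc, mul_inv_cancel₀ hbn.ne', one_mul]
  set σ : ℝ := if 0 ≤ c then 1 else -1 with hσdef
  have hσabs : |σ| = 1 := by rw [hσdef]; split_ifs <;> simp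
  set t : ℝ := L / 4 with htdef
  have ht : 0 < t := by positivity
  have hLt : L = 4 * t := by rw [htdef]; ring
  set z₀ : EuclideanSpace ℝ (Fin 3) := (-(σ * (2 * t))) • e with hz₀def
  have hz₀n : ‖z₀‖ = 2 * t := by
    rw [hz₀def, norm_smul, he, mul_one, Real.norm_eq_abs, abs_neg, abs_mul, hσabs, one_mul,
      abs_of_pos (by positivity)]
  have hsub : ball z₀ t ⊆ ball (0 : EuclideanSpace ℝ (Fin 3)) L := fun Y hY => by
    rw [mem_ball_zero_iff]
    rw [mem_ball, dist_eq_norm] at hY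
    calc ‖Y‖ = ‖(Y - z₀) + z₀‖ := by rw [sub_add_cancel]
      _ ≤ ‖Y - z₀‖ + ‖z₀‖ := norm_add_le _ _
      _ < t + 2 * t := add_lt_add_of_lt_of_le hY hz₀n.le
      _ < L := by rw [hLt]; linarith
  -- the lower bound on the quarter ball
  have hlow : ∀ Y ∈ ball z₀ t, ‖b‖ * t ≤ |⟪b, Y⟫ - c| := by
    intro Y hY
    rw [mem_ball, dist_eq_norm] at hY
    have h1 : ⟪b, Y⟫ = ‖b‖ * ⟪e, Y⟫ := hbe Y
    have h2 : ⟪e, z₀⟫ = -(σ * (2 * t)) := by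
      rw [hz₀def, real_inner_smul_right, real_inner_self_eq_norm_sq, he]
      ring
    have h3 : |⟪e, Y - z₀⟫| ≤ ‖Y - z₀‖ :=
      (abs_real_inner_le_norm _ _).trans (by rw [he, one_mul])
    have h4 : ⟪e, Y⟫ = ⟪e, Y - z₀⟫ + ⟪e, z₀⟫ := by rw [← inner_add_right, sub_add_cancel]
    have h5 := abs_le.1 h3
    rcases le_or_gt 0 c with hc | hc
    · have hσ : σ = 1 := by rw [hσdef, if_pos hc]
      have hY' : ⟪e, Y⟫ ≤ -t := by rw [h4, h2, hσ]; linarith [h5.2]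
      have h6 : ⟪b, Y⟫ - c ≤ -(‖b‖ * t) := by
        rw [h1]; nlinarith
      calc ‖b‖ * t ≤ -(⟪b, Y⟫ - c) := by linarith
        _ ≤ |⟪b, Y⟫ - c| := neg_le_abs _
    · have hσ : σ = -1 := by rw [hσdef, if_neg (not_le.2 hc)]
      have hY' : t ≤ ⟪e, Y⟫ := by rw [h4, h2, hσ]; linarith [h5.1]
      have h6 : ‖b‖ * t ≤ ⟪b, Y⟫ - c := by
        rw [h1]; nlinarith
      exact h6.trans (le_abs_self _)
  -- integrate over the quarter ball
  have hvolB : (volume (ball z₀ t)).toReal = t ^ 3 * v₁ := by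
    rw [Measure.addHaar_ball_of_pos volume z₀ ht, finrank_euclideanSpace_fin, ENNReal.toReal_mul,
      ENNReal.toReal_ofReal (pow_nonneg ht.le 3), hv₁]
  have hconst : ∫ Y in ball z₀ t, (‖b‖ * t) ^ (3 / 2 : ℝ) = (‖b‖ * t) ^ (3 / 2 : ℝ) * (t ^ 3 * v₁) := by
    rw [setIntegral_const, smul_eq_mul, measureReal_def, hvolB, mul_comm]
  have hmono1 : ∫ Y in ball z₀ t, (‖b‖ * t) ^ (3 / 2 : ℝ) ≤ ∫ Y in ball z₀ t, f Y := by
    refine setIntegral_mono_on ?_ (hfi.mono_set hsub) measurableSet_ball fun Y hY => ?_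
    · exact (integrableOn_const_iff (C := (‖b‖ * t) ^ (3 / 2 : ℝ))).2 (Or.inr measure_ball_lt_top)
    · exact Real.rpow_le_rpow (by positivity) (hlow Y hY) (by norm_num)
  have hmono2 : ∫ Y in ball z₀ t, f Y ≤ ∫ Y in ball (0 : EuclideanSpace ℝ (Fin 3)) L, f Y :=
    setIntegral_mono_set hfi (ae_of_all _ fun Y => hf0 Y) hsub.eventuallyLE
  -- the constant: `(v₁/512) ‖b‖^{3/2} L^{9/2} = (‖b‖ t)^{3/2} t³ v₁` with `L = 4t`
  have halg : v₁ / 512 * ‖b‖ ^ (3 / 2 : ℝ) * L ^ (9 / 2 : ℝ) = (‖b‖ * t) ^ (3 / 2 : ℝ) * (t ^ 3 * v₁) := by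
    have e1 : L ^ (9 / 2 : ℝ) = 512 * t ^ (9 / 2 : ℝ) := by
      rw [hLt, Real.mul_rpow (by norm_num) ht.le, four_rpow_nine_halves]
    have e2 : t ^ (9 / 2 : ℝ) = t ^ (3 / 2 : ℝ) * t ^ 3 := by
      rw [show (9 / 2 : ℝ) = 3 / 2 + 3 by norm_num, Real.rpow_add ht]
      congr 1
      exact_mod_cast Real.rpow_natCast t 3
    have e3 : (‖b‖ * t) ^ (3 / 2 : ℝ) = ‖b‖ ^ (3 / 2 : ℝ) * t ^ (3 / 2 : ℝ) := Real.mul_rpow hbn.le ht.le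
    rw [e1, e2, e3]
    ring
  rw [halg, ← hconst]
  exact hmono1.trans hmono2

end Summit.NavierStokesRegularity.NavierStokesRegularity.Theorems.PowerGaugeEulerLiouville.GalileanFrames

end
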